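import Literature.NumberTheory.EllipticCurves.ShaRestriction
import Mathlib.FieldTheory.KrullTopology
import Mathlib.FieldTheory.Normal.Closure
import HarnessLib

/-!
# The kernel of `Ш(E/K) → Ш(E_L/L)` is killed by the degree (res ∘ cor without cor)

Sibling of `Literature.NumberTheory.EllipticCurves.ShaRestriction` (everything here is proved).
For an elliptic curve `E` (Weierstrass curve `W`) over a number field `K` and a finite extension
`L/K` with Galois closure `L̃/K` (inside `K̄`), every class in the kernel of the restriction
`H¹(K, E) → H¹(L, E)` — in particular every class in the kernel of `Ш(E/K) → Ш(E_L/L)`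
(`Literature.NumberTheory.EllipticCurves.shaRestriction`) — is killed by `[L̃ : K]`; for `L/K` Galois, by `[L : K]`. Consequently
restriction is injective on `Ш(E/K)[n]` for every `n` prime to `[L : K]` (`L/K` Galois).

This is the classical corollary "`cor ∘ res = [L : K]`, so `ker(res)` is `[L : K]`-torsion"
(Serre, *Galois Cohomology*, I.§2.4, Cor. to Prop. 9; Silverman, *AEC*, App. B), obtained here
without corestriction from the two facts already proved in `ShaRestriction`: the kernel of
restriction consists of classes inflated from crossed homomorphisms vanishing on the open normal
subgroup `Γ_{L̃} ≤ Γ_K` (`Literature.NumberTheory.EllipticCurves.resKer_le_range_inflClass`), and `[Γ_K : Γ_{L̃}]` kills those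
(`Literature.NumberTheory.EllipticCurves.index_nsmul_inflClass`); plus `[Γ_K : Γ_{L̃}] = [L̃ : K]` (Mathlib's
`IntermediateField.finrank_eq_fixingSubgroup_index`, Krull topology) and `L̃ ≅ L` for `L/K`
normal (Mathlib's uniqueness of normal closures `IsNormalClosure.equiv`, through
`isNormalClosure_self`: a normal extension is its own normal closure).

It is the step "Since `n = [K : ℚ]` is odd, the kernel of the restriction map
`Ш(B/ℚ) → Ш(B/K)` has no element of order `2`" of K. Matsuno, Math. Res. Lett. 16 (2009),
proof of Prop. 5.7 (p. 458).

## Main statements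

* `Literature.NumberTheory.EllipticCurves.isNormalClosure_self`: `[Normal K L] → IsNormalClosure K L L`.
* `Literature.NumberTheory.EllipticCurves.finrank_galoisClosureIn_eq` : for `L/K` Galois, `[L̃ : K] = [L : K]`.
* `Literature.NumberTheory.EllipticCurves.index_galSubgroupClosure_eq_finrank` : `[Γ_K : Γ_{L̃}] = [L̃ : K]`.
* `Literature.NumberTheory.EllipticCurves.index_nsmul_eq_zero_of_mem_localRestrictionKer` : `c ∈ ker(H¹(K,E) → H¹(L,E))` ⇒
  `[Γ_K : Γ_{L̃}] • c = 0`; `Literature.NumberTheory.EllipticCurves.finrank_nsmul_eq_zero_of_mem_localRestrictionKer` (`L/K`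
  Galois): `[L : K] • c = 0`.
* `Literature.NumberTheory.EllipticCurves.finrank_nsmul_eq_zero_of_shaRestriction_eq_zero` (`L/K` Galois):
  `shaRestriction c = 0 → [L : K] • c = 0`;
  `Literature.NumberTheory.EllipticCurves.shaRestriction_eq_zero_iff_of_coprime`, `Literature.NumberTheory.EllipticCurves.injOn_shaRestriction_torsionBy`:
  on `Ш(E/K)[n]` with `n` coprime to `[L : K]` restriction is injective.

## References

* J.-P. Serre, *Galois Cohomology*, Springer (1997), I.§2.4 (Prop. 9 and Cor.), I.§5.8.
  [SerreGaloisCohomology1997]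
* J. H. Silverman, *The Arithmetic of Elliptic Curves*, 2nd ed. (2009), App. B (res, cor).
  [SilvermanAEC2009]
* K. Matsuno, Math. Res. Lett. 16 (2009), 449–461, proof of Prop. 5.7 (p. 458).
  [Matsuno2009]
-/

noncomputable section

open scoped Classical

universe u

namespace Literature.NumberTheory.EllipticCurves

/-! ## A normal extension is its own normal closure -/

section NormalClosure

open IntermediateField

/-- **A normal extension is a normal closure of itself**: the minimal polynomials split in `L`
(normality) and their roots generate `L` (each `x` is a root of its own minimal polynomial).
[folklore] -/
theorem isNormalClosure_self (K L : Type*) [Field K] [Field L] [Algebra K L] [Normal K L] :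
    IsNormalClosure K L L where
  splits x := Normal.splits inferInstance x
  adjoin_rootSet := by
    rw [eq_top_iff]
    intro x _
    have hx : x ∈ (minpoly K x).rootSet L := by
      rw [Polynomial.mem_rootSet]
      exact ⟨minpoly.ne_zero (Normal.isIntegral inferInstance x), minpoly.aeval K x⟩
    exact le_iSup (fun y : L => adjoin K ((minpoly K y).rootSet L)) x (subset_adjoin K _ hx)

variable {K : Type u} [Field K] (L : Type u) [Field L] [Algebra K L]

/-- **`[L̃ : K] = [L : K]` for `L/K` Galois**: the Galois closure `L̃` of `L/K` in `K̄`
(`Literature.galoisClosureIn L`, Mathlib's `normalClosure K L K̄`) is a normal closure of `L/K`, as is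
`L` itself, and normal closures are isomorphic (`IsNormalClosure.equiv`). [folklore] -/
theorem finrank_galoisClosureIn_eq [IsGalois K L] :
    Module.finrank K (galoisClosureIn (K := K) L) = Module.finrank K L := by
  haveI : Normal K (AlgebraicClosure K) := IsAlgClosure.normal K (AlgebraicClosure K)
  haveI : Nonempty (L →ₐ[K] AlgebraicClosure K) := ⟨IsAlgClosed.lift⟩
  haveI : IsNormalClosure K L L := isNormalClosure_self K L
  haveI : IsNormalClosure K L (galoisClosureIn (K := K) L) := by
    unfold galoisClosureIn; infer_instance
  exact (IsNormalClosure.equiv (F := K) (K := L) (L := L)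
    (L' := galoisClosureIn (K := K) L)).toLinearEquiv.finrank_eq.symm

variable [NumberField K]

/-- **`[Γ_K : Γ_{L̃}] = [L̃ : K]`** (infinite Galois theory for `K̄/K`, Mathlib's
`IntermediateField.finrank_eq_fixingSubgroup_index`). [folklore] -/
theorem index_galSubgroupClosure_eq_finrank :
    (galSubgroupClosure (K := K) L).index = Module.finrank K (galoisClosureIn (K := K) L) := by
  haveI : IsGalois K (AlgebraicClosure K) := {}
  exact (IntermediateField.finrank_eq_fixingSubgroup_index (galoisClosureIn (K := K) L)).symm

/-- For `L/K` Galois, `[Γ_K : Γ_{L̃}] = [L : K]`. [folklore] -/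
theorem index_galSubgroupClosure_eq_finrank_of_isGalois [IsGalois K L] :
    (galSubgroupClosure (K := K) L).index = Module.finrank K L :=
  (index_galSubgroupClosure_eq_finrank L).trans (finrank_galoisClosureIn_eq L)

end NormalClosure

/-! ## The kernel of restriction is killed by the degree -/

section Kernel

variable {K : Type u} [Field K] [NumberField K] (W : WeierstrassCurve K)
variable (L : Type u) [Field L] [NumberField L] [Algebra K L]

/-- **`[Γ_K : Γ_{L̃}]` kills `ker(H¹(K, E) → H¹(L, E))`.** A class dying over `L` is inflated from
a crossed homomorphism vanishing on `Γ_{L̃}` (`resKer_le_range_inflClass`), and such classes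
are killed by the index (`index_nsmul_inflClass`). Serre, *Galois Cohomology*, I.§2.4 (Cor. to
Prop. 9) and I.§5.8. [cite: SerreGaloisCohomology1997, I.§2.4 Cor. to Prop. 9] -/
theorem index_nsmul_eq_zero_of_mem_localRestrictionKer (c : W.galH1)
    (hc : c ∈ W.localRestrictionKer L) : (galSubgroupClosure (K := K) L).index • c = 0 := by
  haveI : FiniteDimensional K L := Module.Finite.of_restrictScalars_finite ℚ K L
  obtain ⟨f, rfl⟩ := resKer_le_range_inflClass (resGal (K := K) L) (pointsMap W L)
    (pointsMap_smul W L) (pointsMapOfEmb_bijective L W _) (galSubgroupClosure (K := K) L)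
    (isOpen_galSubgroupClosure L) (galSubgroupClosure_le_range_resGal L) hc
  exact index_nsmul_inflClass (galSubgroupClosure (K := K) L) (isOpen_galSubgroupClosure L) f

/-- **`[L̃ : K]` kills `ker(H¹(K, E) → H¹(L, E))`.**
[cite: SerreGaloisCohomology1997, I.§2.4 Cor. to Prop. 9] -/
theorem finrank_galoisClosureIn_nsmul_eq_zero_of_mem_localRestrictionKer (c : W.galH1)
    (hc : c ∈ W.localRestrictionKer L) :
    Module.finrank K (galoisClosureIn (K := K) L) • c = 0 := by
  rw [← index_galSubgroupClosure_eq_finrank L]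
  exact index_nsmul_eq_zero_of_mem_localRestrictionKer W L c hc

/-- **For `L/K` Galois, `[L : K]` kills `ker(H¹(K, E) → H¹(L, E))`** ("`cor ∘ res = [L : K]`").
[cite: SerreGaloisCohomology1997, I.§2.4 Cor. to Prop. 9] -/
theorem finrank_nsmul_eq_zero_of_mem_localRestrictionKer [IsGalois K L] (c : W.galH1)
    (hc : c ∈ W.localRestrictionKer L) : Module.finrank K L • c = 0 := by
  rw [← index_galSubgroupClosure_eq_finrank_of_isGalois L]
  exact index_nsmul_eq_zero_of_mem_localRestrictionKer W L c hc

/-- **For `L/K` Galois, `[L : K]` kills the kernel of `Ш(E/K) → Ш(E_L/L)`** (Matsuno 2009,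
proof of Prop. 5.7: "the kernel of the restriction map `Ш(B/ℚ) → Ш(B/K)`" is `[K : ℚ]`-torsion).
[cite: SerreGaloisCohomology1997, I.§2.4 Cor. to Prop. 9] [cite: Matsuno2009, proof of Prop. 5.7] -/
theorem finrank_nsmul_eq_zero_of_shaRestriction_eq_zero [IsGalois K L] (c : W.sha)
    (hc : shaRestriction W L c = 0) : Module.finrank K L • c = 0 := by
  apply Subtype.ext
  have h0 : resBaseChange W L c = 0 := congrArg Subtype.val hc
  have := finrank_nsmul_eq_zero_of_mem_localRestrictionKer W L (c : W.galH1)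
    ((mem_ker_resBaseChange_iff W L c).mp h0)
  simpa using this

/-- **Restriction is injective on `Ш(E/K)[n]` for `n` prime to `[L : K]`** (`L/K` Galois): a
class killed both by `n` and by `[L : K]` is `0`. For `[K : ℚ]` odd and `n = 2`: "the kernel of
the restriction map `Ш(B/ℚ) → Ш(B/K)` has no element of order `2`" (Matsuno 2009, proof of
Prop. 5.7). [cite: Matsuno2009, proof of Prop. 5.7]
[cite: SerreGaloisCohomology1997, I.§2.4 Cor. to Prop. 9] -/
theorem shaRestriction_eq_zero_iff_of_coprime [IsGalois K L] {n : ℕ}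
    (hn : n.Coprime (Module.finrank K L)) (c : W.sha) (hc : n • c = 0) :
    shaRestriction W L c = 0 ↔ c = 0 := by
  refine ⟨fun h => ?_, fun h => by rw [h, map_zero]⟩
  have hd := finrank_nsmul_eq_zero_of_shaRestriction_eq_zero W L c h
  obtain ⟨a, b, hab⟩ : ∃ a b : ℤ, a * n + b * Module.finrank K L = 1 := by
    have := Nat.Coprime.isCoprime hn  -- IsCoprime (n : ℤ) (finrank : ℤ)
    obtain ⟨a, b, h⟩ := this
    exact ⟨a, b, h⟩
  have key : ((a * n + b * Module.finrank K L : ℤ)) • c = c := by rw [hab, one_zsmul]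
  rw [← key, add_zsmul, mul_zsmul, mul_zsmul, natCast_zsmul, natCast_zsmul, hc, hd, zsmul_zero,
    zsmul_zero, add_zero]

/-- **Injectivity on `Ш(E/K)[n]`** (`L/K` Galois, `n` prime to `[L : K]`), as `Set.InjOn`.
[cite: SerreGaloisCohomology1997, I.§2.4 Cor. to Prop. 9] [cite: Matsuno2009, proof of Prop. 5.7] -/
theorem injOn_shaRestriction_torsionBy [IsGalois K L] {n : ℕ}
    (hn : n.Coprime (Module.finrank K L)) :
    Set.InjOn (shaRestriction W L) (AddSubgroup.torsionBy W.sha n : Set W.sha) := by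
  intro c hc c' hc' h
  rw [SetLike.mem_coe, AddSubgroup.torsionBy.nsmul_iff] at hc hc'
  have h0 : shaRestriction W L (c - c') = 0 := by rw [map_sub, h, sub_self]
  have := (shaRestriction_eq_zero_iff_of_coprime W L hn (c - c')
    (by rw [nsmul_sub, hc, hc', sub_zero])).mp h0
  exact sub_eq_zero.mp this

end Kernel

end Literature.NumberTheory.EllipticCurves

end
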